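import Summits.Ventures.Crystal3D.Bulk.GapDegrees
import Literature.Geometry.DiscreteGeometry.SphericalCodeHemisphere
import HarnessLib

/-!
# The shell of an admissible configuration meets every open hemisphere (E6) and has the centre
# in the interior of its convex hull

HONEST FRAMING. Part of the venture `Summits/Ventures/Crystal3D` (cell `pub-crystal3d`, phase 2,
24-hour sprint `PLAN.md` R42; seat typer-bulk-2). Row E6 of the cell's `DESIGN-L12-THEORY.md`
(validity table T1: "`V(T′) ⊄` any closed hemisphere; a fortiori for `X`, `X ∪ {p}`"), in the
fourteen-ball vocabulary of `Bulk/GapCensusSkeleton.lean`, for EVERY admissible configuration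
(`IsGapConfig`, no extremality): the twelve shell vectors `c j − c 0` (`j ∉ {0, 13}`) are unit
vectors pairwise at inner product `≤ 1/2`, so by the tree's cap-area theorem
`Literature…SphericalCodeHemisphere.exists_inner_neg_of_twelve` (twelve `30°`-caps do not fit in a
closed hemisphere) every nonzero `v` has a shell vector at negative inner product
(`IsGapConfig.exists_shell_inner_neg`, and `…_inner_pos`), and by the tree's Hahn–Banach lemma the
centre `0` is in the interior of the convex hull of the shell vectors
(`IsGapConfig.zero_mem_interior_convexHull_shell`) — the standing hypothesis of the hull-face /
planarity theory (P-L3). Nothing numerical beyond `√3 < 1.75`; nothing claimed about GAP(1.26).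
-/

noncomputable section

open scoped BigOperators InnerProductSpace
open Finset

namespace Summit.Ventures.Crystal3D

open Literature.Geometry.DiscreteGeometry

variable {c : Fin 14 → EuclideanSpace ℝ (Fin 3)}

/-- The twelve shell labels. -/
theorem card_filter_shell :
    (univ.filter fun j : Fin 14 => j ≠ 0 ∧ j ≠ 13).card = 12 := by decide

/-- The shell vectors of an admissible configuration are twelve distinct unit vectors. -/
theorem IsGapConfig.card_image_shell (hc : IsGapConfig c) :
    ((univ.filter fun j : Fin 14 => j ≠ 0 ∧ j ≠ 13).image fun j => c j - c 0).card = 12 := by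
  classical
  rw [card_image_of_injOn fun j _ k _ h => hc.injective (sub_left_injective h)]
  exact card_filter_shell

/-- **E6 for the shell.** For every nonzero `v`, some shell vector of an admissible configuration
has negative inner product with `v`: the shell lies in no closed hemisphere (tree
`exists_inner_neg_of_twelve` with cap parameter `c = √3/2`, i.e. pairwise `≥ 60°`). -/
theorem IsGapConfig.exists_shell_inner_neg (hc : IsGapConfig c) {v : EuclideanSpace ℝ (Fin 3)}
    (hv : v ≠ 0) : ∃ j : Fin 14, j ≠ 0 ∧ j ≠ 13 ∧ ⟪v, c j - c 0⟫_ℝ < 0 := by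
  classical
  set X := (univ.filter fun j : Fin 14 => j ≠ 0 ∧ j ≠ 13).image fun j => c j - c 0 with hX
  have hX1 : ∀ x ∈ X, ‖x‖ = 1 := by
    intro x hx
    obtain ⟨j, hj, rfl⟩ := mem_image.1 hx
    obtain ⟨hj0, hj13⟩ := (mem_filter.1 hj).2
    exact hc.norm_sub_eq_one hj0 hj13
  have hsep : ∀ x ∈ X, ∀ x' ∈ X, x ≠ x' → ⟪x, x'⟫_ℝ ≤ 2 * (Real.sqrt 3 / 2) ^ 2 - 1 := by
    intro x hx x' hx' hne
    obtain ⟨j, hj, rfl⟩ := mem_image.1 hx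
    obtain ⟨k, hk, rfl⟩ := mem_image.1 hx'
    obtain ⟨hj0, hj13⟩ := (mem_filter.1 hj).2
    obtain ⟨hk0, hk13⟩ := (mem_filter.1 hk).2
    have hjk : j ≠ k := fun h => hne (by rw [h])
    have h3 : (Real.sqrt 3) ^ 2 = 3 := Real.sq_sqrt (by norm_num)
    have := hc.inner_sub_le_half hj0 hj13 hk0 hk13 hjk
    nlinarith [h3]
  have hs : Real.sqrt 3 < 1.75 := by
    rw [Real.sqrt_lt' (by norm_num)]; norm_num
  have hs1 : Real.sqrt 3 ≤ 2 := by linarith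
  have hq : Real.sqrt (1 - (Real.sqrt 3 / 2) ^ 2) = 1 / 2 := by
    have h3 : (Real.sqrt 3) ^ 2 = 3 := Real.sq_sqrt (by norm_num)
    rw [show 1 - (Real.sqrt 3 / 2) ^ 2 = (1 / 2 : ℝ) ^ 2 by nlinarith [h3]]
    exact Real.sqrt_sq (by norm_num)
  have hnum : 1 + Real.sqrt (1 - (Real.sqrt 3 / 2) ^ 2) < 12 * (1 - Real.sqrt 3 / 2) := by
    rw [hq]; linarith
  have hpos : 0 < Real.sqrt 3 / 2 := by positivity
  obtain ⟨x, hx, hneg⟩ :=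
    exists_inner_neg_of_twelve hX1 hc.card_image_shell hpos (by linarith) hnum hsep hv
  obtain ⟨j, hj, rfl⟩ := mem_image.1 hx
  obtain ⟨hj0, hj13⟩ := (mem_filter.1 hj).2
  exact ⟨j, hj0, hj13, hneg⟩

/-- The same with the opposite sign: some shell vector has positive inner product with `v`. -/
theorem IsGapConfig.exists_shell_inner_pos (hc : IsGapConfig c) {v : EuclideanSpace ℝ (Fin 3)}
    (hv : v ≠ 0) : ∃ j : Fin 14, j ≠ 0 ∧ j ≠ 13 ∧ 0 < ⟪v, c j - c 0⟫_ℝ := by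
  obtain ⟨j, hj0, hj13, h⟩ := hc.exists_shell_inner_neg (neg_ne_zero.2 hv)
  exact ⟨j, hj0, hj13, by rwa [inner_neg_left, neg_lt_zero] at h⟩

/-- **The centre is in the interior of the convex hull of the shell vectors** (tree
`zero_mem_interior_convexHull_of_twelve_soft` at `κ = 1/2`): the standing hypothesis of the
hull-face theory behind the planarity/face lemmas P-L3. -/
theorem IsGapConfig.zero_mem_interior_convexHull_shell (hc : IsGapConfig c) :
    (0 : EuclideanSpace ℝ (Fin 3)) ∈ interior (convexHull ℝ
      (((univ.filter fun j : Fin 14 => j ≠ 0 ∧ j ≠ 13).image fun j => c j - c 0 :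
        Finset (EuclideanSpace ℝ (Fin 3))) : Set (EuclideanSpace ℝ (Fin 3)))) := by
  classical
  refine zero_mem_interior_convexHull_of_twelve_soft ?_ hc.card_image_shell (κ := 1 / 2)
    (by norm_num) ?_
  · intro x hx
    obtain ⟨j, hj, rfl⟩ := mem_image.1 hx
    obtain ⟨hj0, hj13⟩ := (mem_filter.1 hj).2
    exact hc.norm_sub_eq_one hj0 hj13
  · intro x hx x' hx' hne
    obtain ⟨j, hj, rfl⟩ := mem_image.1 hx
    obtain ⟨k, hk, rfl⟩ := mem_image.1 hx'
    obtain ⟨hj0, hj13⟩ := (mem_filter.1 hj).2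
    obtain ⟨hk0, hk13⟩ := (mem_filter.1 hk).2
    have hjk : j ≠ k := fun h => hne (by rw [h])
    exact hc.inner_sub_le_half hj0 hj13 hk0 hk13 hjk

/-- **E6 for shell plus intruder direction**: a fortiori, for every nonzero `v` some ball
`j ≠ 0` (shell ball or intruder) has `⟪v, c j − c 0⟫ < 0`. -/
theorem IsGapConfig.exists_inner_neg (hc : IsGapConfig c) {v : EuclideanSpace ℝ (Fin 3)}
    (hv : v ≠ 0) : ∃ j : Fin 14, j ≠ 0 ∧ ⟪v, c j - c 0⟫_ℝ < 0 := by
  obtain ⟨j, hj0, -, h⟩ := hc.exists_shell_inner_neg hv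
  exact ⟨j, hj0, h⟩

end Summit.Ventures.Crystal3D

end
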